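import Summits.Langlands.Langlands.Theorems.LevelOneDyadicRigidity

/-!
# Level-one dyadic companions, part 5: Katz's basic trichotomy — the minimal dyadic counterexample is Lie-irreducible

Tree twin (Theorems side, NO route-file import) of the decomp-langlands lens-4 g9 node `LieIrreducibleNormalForm`
(HOME/nodes/lens-4-g9-LieIrreducibleNormalForm.lean).  Target T = `LevelOneDyadic.DyadicContinuousCompanion` (part 4,
`LevelOneDyadicRigidity.lean`; = route item stmt-Langlands-31993 `DyadicCompanionSplit.DyadicContinuousCompanion`, same text).

* Vocabulary: `HasDyadicCompanion`, `IsLieIrreducible` (restriction to every finite extension stays irreducible), `DimSlice`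
  (T's dimension-m slice), the isotypic restriction pattern.
* Pieces: R = `LieIrreducibleCompanion` (T on the Lie-irreducible class), D′ = `CliffordCompanionStep` (a non-Lie-irreducible
  irreducible level-one ρ has a dyadic companion provided all smaller-dimensional level-one irreducibles over all number fields
  do), and one layer down C = `CliffordReduction` (Clifford–Mackey–Katz trichotomy with level-one heredity: PRINT, stated as a
  Prop), D = `IsotypicCompanionDescent` (descent of a companion along an isotypic layer); rung `CliffordCompanionStepPrimeDim`.
* Kernels (0 sorry, axioms standard): T ⟹ R, D′, D (drop hypotheses); T ⟸ R ∧ D′ by strong induction on the dimension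
  (`dyadicContinuousCompanion_of_pieces`), T ⟺ R ∧ D′ (`dyadicContinuousCompanion_iff_pieces`); D′ ⟸ C ∧ D
  (`cliffordCompanionStep_of_split`); Langlands ⟹ R, D′, D; E ⟸ R ∧ D′ ∧ G; `langlands_of_pieces₉` (14 binders, through part 4's
  `langlands_of_four`).
Source of the cut: N. M. Katz, *Exponential Sums and Differential Equations*, Annals of Math. Studies 124, §2.7 «A Basic
Trichotomy», Prop. 2.7.2 / Lemma 2.7.2.1 [corpus:book:katz1990-exponential-sums-differential-equations p.50–53] (= Clifford 1937
+ Mackey for an open normal subgroup).  No new definitions of mathematical objects beyond Props; no new axioms.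
-/

set_option linter.dupNamespace false

namespace Summit.Langlands.Langlands.Theorems.LevelOneDyadic.Clifford

open scoped NumberField
open Filter IsDedekindDomain
open Literature.NumberTheory.GaloisRepresentations Literature.NumberTheory.Automorphic
open Summit.Langlands.Langlands.Theorems.LevelOneDyadic (IsPinnedGeometric IsCrystallineAbove IsUnramifiedAwayFrom
  CompanionMatch)

/-! ## Vocabulary (helper predicates; the filed texts inline them verbatim — bridges are `Iff.rfl`) -/

section Vocabulary

variable {K : Type} [Field K] [NumberField K] {ℓ : ℕ} [Fact ℓ.Prime] {n : ℕ}

/-- `ρ` HAS A DYADIC COMPANION through (ι, ι₂): a continuous a.e.-unramified `ρ₂ : Γ_K → GL_n(ℚ̄₂)` with matching Frobenius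
polynomials at almost all places (exactly T's conclusion for ρ). -/
def HasDyadicCompanion (ι : PadicAlgCl ℓ ≃+* ℂ) (ι₂ : PadicAlgCl 2 ≃+* ℂ) (ρ : FramedGaloisRep K (PadicAlgCl ℓ) n) : Prop :=
  ∃ ρ₂ : FramedGaloisRep K (PadicAlgCl 2) n, (∀ᶠ v : HeightOneSpectrum (𝓞 K) in cofinite, ρ₂.IsUnramifiedAt v) ∧
    CompanionMatch ι ι₂ ρ ρ₂

/-- The DIMENSION-`m` SLICE of T: T's statement for all number fields `L` and all irreducible level-one
`σ : Γ_L → GL_m(ℚ̄_ℓ)` (all odd ℓ, all ι, ι₂).  `T ↔ ∀ m, DimSlice m` (`routeT_iff_slices`); the induction hypothesis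
of the Clifford step D′ is `∀ m < n, DimSlice m`. -/
def DimSlice (m : ℕ) : Prop :=
  ∀ (L : Type) [Field L] [NumberField L], 0 < m → ∀ (ℓ : ℕ) [Fact ℓ.Prime], ℓ ≠ 2 → ∀ (ι : PadicAlgCl ℓ ≃+* ℂ)
    (σ : FramedGaloisRep L (PadicAlgCl ℓ) m), σ.toGaloisRep.IsIrreducible → IsPinnedGeometric σ → IsCrystallineAbove σ →
      IsUnramifiedAwayFrom σ → ∀ (ι₂ : PadicAlgCl 2 ≃+* ℂ), HasDyadicCompanion ι ι₂ σ

/-- `ρ` is LIE-IRREDUCIBLE: its restriction to `Γ_L` stays irreducible for EVERY finite extension `L/K` (typed: every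
number field `L` with a `K`-algebra structure; restriction along the tree's `absGaloisRestrict K L`).  Equivalently the
identity component of the algebraic monodromy group acts irreducibly.  Ref: Patrikis, *Variations on a theorem of Tate*,
Mem. AMS 1238 (2019) §1.2; Katz, *Exponential sums and differential equations* §2.10 («Lie-irreducible»). -/
def IsLieIrreducible (ρ : FramedGaloisRep K (PadicAlgCl ℓ) n) : Prop :=
  ∀ (L : Type) [Field L] [NumberField L] [Algebra K L], (ρ.restrictField L).toGaloisRep.IsIrreducible

/-- `σ` over `L` is an ISOTYPIC PATTERN of `ρ` of multiplicity `a`: `charpoly (ρ|Γ_L)(g) = (charpoly σ(g))^a` for all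
`g ∈ Γ_L` (for `σ` irreducible in characteristic 0 this is `(ρ|Γ_L)^ss ≅ σ^{⊕a}`, Brauer–Nesbitt). -/
def IsIsotypicPattern (L : Type) [Field L] [Algebra K L] {m : ℕ} (ρ : FramedGaloisRep K (PadicAlgCl ℓ) n)
    (σ : FramedGaloisRep L (PadicAlgCl ℓ) m) (a : ℕ) : Prop :=
  ∀ g : Field.absoluteGaloisGroup L, FramedRep.charpoly (ρ.restrictField L) g = (FramedRep.charpoly σ g) ^ a

end Vocabulary

/-! ## The pieces — ONE-LINE self-contained Props over tree declarations (= the texts of `texts.json`) -/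

/-- [crux · rank 2 · R · DECLARED RESIDUAL of the lens-4 lineage after g9 · WEAKER than T (`lieIrreducibleCompanion_of_T`)
and than the summit (`…_of_langlands`)]
LIE-IRREDUCIBLE DYADIC COMPANION: T for the ρ whose restriction to EVERY finite extension stays irreducible (connected-
irreducible ℓ-adic monodromy).  Why it might fail: off the polarisable-regular (BLGGT Thm 5.4.1) and CM-regular (HLTT/
Scholze + A'Campo 2023) sectors nothing produces a 2-adic avatar of an abstract Lie-irreducible crystalline ρ — Deligne's
companion problem over a number field (Esnault 2023 p. 60); the cut only removes the disconnected part of the darkness. -/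
def LieIrreducibleCompanion : Prop :=
  ∀ (K : Type) [Field K] [NumberField K] (n : ℕ), 0 < n → ∀ (ℓ : ℕ) [Fact ℓ.Prime], ℓ ≠ 2 → ∀ (ι : PadicAlgCl ℓ ≃+* ℂ) (ρ : Literature.NumberTheory.GaloisRepresentations.FramedGaloisRep K (PadicAlgCl ℓ) n), ρ.toGaloisRep.IsIrreducible → (∀ (L : Type) [Field L] [NumberField L] [Algebra K L], (ρ.restrictField L).toGaloisRep.IsIrreducible) → ((∀ᶠ v : IsDedekindDomain.HeightOneSpectrum (NumberField.RingOfIntegers K) in cofinite, ρ.IsUnramifiedAt v) ∧ ∀ (v : IsDedekindDomain.HeightOneSpectrum (NumberField.RingOfIntegers K)) (hv : ((ℓ : ℕ) : NumberField.RingOfIntegers K) ∈ v.asIdeal), (Literature.NumberTheory.PAdicHodge.fontainePstAdicCompletion v ℓ hv).IsDeRhamFramed (ρ.toLocal v)) → (∀ (v : IsDedekindDomain.HeightOneSpectrum (NumberField.RingOfIntegers K)) (hv : ((ℓ : ℕ) : NumberField.RingOfIntegers K) ∈ v.asIdeal), (Literature.NumberTheory.PAdicHodge.fontainePstAdicCompletion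 v ℓ hv).IsCrystallineFramed (ρ.toLocal v)) → (∀ w : IsDedekindDomain.HeightOneSpectrum (NumberField.RingOfIntegers K), ((ℓ : ℕ) : NumberField.RingOfIntegers K) ∉ w.asIdeal → ρ.IsUnramifiedAt w) → ∀ (ι₂ : PadicAlgCl 2 ≃+* ℂ), ∃ ρ₂ : Literature.NumberTheory.GaloisRepresentations.FramedGaloisRep K (PadicAlgCl 2) n, (∀ᶠ v : IsDedekindDomain.HeightOneSpectrum (NumberField.RingOfIntegers K) in cofinite, ρ₂.IsUnramifiedAt v) ∧ (∀ᶠ v : IsDedekindDomain.HeightOneSpectrum (NumberField.RingOfIntegers K) in cofinite, ∃ α : Multiset ℂ, ρ.HasFrobCharpolyAt v (Literature.NumberTheory.Automorphic.arithFrobPolyOfSatake ι v.residueCard 1 α) ∧ ρ₂.HasFrobCharpolyAt v (Literature.NumberTheory.Automorphic.arithFrobPolyOfSatake ι₂ v.residueCard 1 α))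

/-- [crux · rank 3 · D′ · WEAKER than T (`cliffordCompanionStep_of_T`: drop the induction hypothesis) and than the summit
(`…_of_langlands`) · ATTACKABLE (PRINT in every prime dimension — rung `CliffordCompanionStepPrimeDim` —, and on the induced
branch; splits one level down as D′ ⟸ C ∧ D, kernel `cliffordCompanionStep_of_split`) · leaf: ATTACKABLE / open core = D]
CLIFFORD COMPANION STEP («the minimal dyadic counterexample is Lie-irreducible»): an irreducible level-one
ρ : Γ_K → GL_n(ℚ̄_ℓ) that is NOT Lie-irreducible has a dyadic companion through (ι, ι₂) PROVIDED every irreducible level-one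
representation of every dimension m < n over every number field has one (T's dimension slices below n, all odd ℓ′, ι′, ι₂′).
Why it might fail: Clifford's induced branch is print (companions induce), but the ISOTYPIC branch needs descent of the
companion along the isotypic layer (= D): for non-solvable everywhere-unramified L/K nothing in print descends an abstract
ℓ′-adic representation; Langlands-implied (kernel). -/
def CliffordCompanionStep : Prop :=
  ∀ (K : Type) [Field K] [NumberField K] (n : ℕ), 0 < n → ∀ (ℓ : ℕ) [Fact ℓ.Prime], ℓ ≠ 2 → ∀ (ι : PadicAlgCl ℓ ≃+* ℂ) (ρ : Literature.NumberTheory.GaloisRepresentations.FramedGaloisRep K (PadicAlgCl ℓ) n), ρ.toGaloisRep.IsIrreducible → ((∀ᶠ v : IsDedekindDomain.HeightOneSpectrum (NumberField.RingOfIntegers K) in cofinite, ρ.IsUnramifiedAt v) ∧ ∀ (v : IsDedekindDomain.HeightOneSpectrum (NumberField.RingOfIntegers K)) (hv : ((ℓ : ℕ) : NumberField.RingOfIntegers K) ∈ v.asIdeal), (Literature.NumberTheory.PAdicHodge.fontainePstAdicCompletion v ℓ hv).IsDeRhamFramed (ρ.toLocal v)) → (∀ (v : IsDedekindDomain.HeightOneSpectrum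 (NumberField.RingOfIntegers K)) (hv : ((ℓ : ℕ) : NumberField.RingOfIntegers K) ∈ v.asIdeal), (Literature.NumberTheory.PAdicHodge.fontainePstAdicCompletion v ℓ hv).IsCrystallineFramed (ρ.toLocal v)) → (∀ w : IsDedekindDomain.HeightOneSpectrum (NumberField.RingOfIntegers K), ((ℓ : ℕ) : NumberField.RingOfIntegers K) ∉ w.asIdeal → ρ.IsUnramifiedAt w) → ¬ (∀ (L : Type) [Field L] [NumberField L] [Algebra K L], (ρ.restrictField L).toGaloisRep.IsIrreducible) → (∀ (m : ℕ), m < n → ∀ (L : Type) [Field L] [NumberField L], 0 < m → ∀ (ℓ : ℕ) [Fact ℓ.Prime], ℓ ≠ 2 → ∀ (ι : PadicAlgCl ℓ ≃+* ℂ) (σ : Literature.NumberTheory.GaloisRepresentations.FramedGaloisRep L (PadicAlgCl ℓ) m), σ.toGaloisRep.IsIrreducible → ((∀ᶠ v : IsDedekindDomain.HeightOneSpectrum (NumberField.RingOfIntegers L) in cofinite, σ.IsUnramifiedAt v) ∧ ∀ (v : IsDedekindDomain.HeightOneSpectrum (NumberField.RingOfIntegers L)) (hv : ((ℓ : ℕ)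 : NumberField.RingOfIntegers L) ∈ v.asIdeal), (Literature.NumberTheory.PAdicHodge.fontainePstAdicCompletion v ℓ hv).IsDeRhamFramed (σ.toLocal v)) → (∀ (v : IsDedekindDomain.HeightOneSpectrum (NumberField.RingOfIntegers L)) (hv : ((ℓ : ℕ) : NumberField.RingOfIntegers L) ∈ v.asIdeal), (Literature.NumberTheory.PAdicHodge.fontainePstAdicCompletion v ℓ hv).IsCrystallineFramed (σ.toLocal v)) → (∀ w : IsDedekindDomain.HeightOneSpectrum (NumberField.RingOfIntegers L), ((ℓ : ℕ) : NumberField.RingOfIntegers L) ∉ w.asIdeal → σ.IsUnramifiedAt w) → ∀ (ι₂ : PadicAlgCl 2 ≃+* ℂ), ∃ σ₂ : Literature.NumberTheory.GaloisRepresentations.FramedGaloisRep L (PadicAlgCl 2) m, (∀ᶠ v : IsDedekindDomain.HeightOneSpectrum (NumberField.RingOfIntegers L) in cofinite, σ₂.IsUnramifiedAt v) ∧ (∀ᶠ v : IsDedekindDomain.HeightOneSpectrum (NumberField.RingOfIntegers L) in cofinite, ∃ α : Multiset ℂ, σ.HasFrobCharpolyAt v (Literature.NumberTheory.Automorphic.arithFrobPolyOfSatake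 ι v.residueCard 1 α) ∧ σ₂.HasFrobCharpolyAt v (Literature.NumberTheory.Automorphic.arithFrobPolyOfSatake ι₂ v.residueCard 1 α))) → ∀ (ι₂ : PadicAlgCl 2 ≃+* ℂ), ∃ ρ₂ : Literature.NumberTheory.GaloisRepresentations.FramedGaloisRep K (PadicAlgCl 2) n, (∀ᶠ v : IsDedekindDomain.HeightOneSpectrum (NumberField.RingOfIntegers K) in cofinite, ρ₂.IsUnramifiedAt v) ∧ (∀ᶠ v : IsDedekindDomain.HeightOneSpectrum (NumberField.RingOfIntegers K) in cofinite, ∃ α : Multiset ℂ, ρ.HasFrobCharpolyAt v (Literature.NumberTheory.Automorphic.arithFrobPolyOfSatake ι v.residueCard 1 α) ∧ ρ₂.HasFrobCharpolyAt v (Literature.NumberTheory.Automorphic.arithFrobPolyOfSatake ι₂ v.residueCard 1 α))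

/-- [BC5 RUNG of D′ · PLAN-ONLY · D′ in PRIME dimension n = p] In prime dimension Clifford theory leaves two shapes for a
non-Lie-irreducible irreducible ρ: ρ ≅ Ind_{Γ_{L₁}}^{Γ_K} χ with [L₁ : K] = p (L₁/K everywhere unramified, χ a level-one
geometric character — companion by class field theory / algebraic Hecke characters, then induce), or ρ|Γ_L ≅ χ^{⊕p} with χ a
Gal(L/K)-stable character (ρ(Γ_L) scalar ⟹ finite projective image ⟹ ρ ≅ τ ⊗ η, τ of finite image by TATE'S LIFTING
THEOREM H²(Γ_K, ℚ/ℤ) = 0, η a geometric character — companion τ^{ι₂⁻¹ι} ⊗ η₂).  PRINT (Clifford 1937; Serre, «Modular forms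
of weight one and Galois representations» §6 (Tate's theorem); Patrikis arXiv:1207.6724 §2); Lean size L (Tate lifting and
a `FramedGaloisRep` tensor product are not in the tree).  OUTSIDE the summit's known regime for p ≥ 5: automorphy of
monomial representations along degree-p extensions with insoluble Galois closure and of Artin ⊗ character with insoluble
projective image is open (strong Artin; `Literature/Barriers/Langlands/SolvableImageBarrier.lean`). -/
def CliffordCompanionStepPrimeDim : Prop :=
  ∀ (K : Type) [Field K] [NumberField K] (n : ℕ), 0 < n → n.Prime → ∀ (ℓ : ℕ) [Fact ℓ.Prime], ℓ ≠ 2 → ∀ (ι : PadicAlgCl ℓ ≃+* ℂ) (ρ : Literature.NumberTheory.GaloisRepresentations.FramedGaloisRep K (PadicAlgCl ℓ) n), ρ.toGaloisRep.IsIrreducible → ((∀ᶠ v : IsDedekindDomain.HeightOneSpectrum (NumberField.RingOfIntegers K) in cofinite, ρ.IsUnramifiedAt v) ∧ ∀ (v : IsDedekindDomain.HeightOneSpectrum (NumberField.RingOfIntegers K)) (hv : ((ℓ : ℕ) : NumberField.RingOfIntegers K) ∈ v.asIdeal), (Literature.NumberTheory.PAdicHodge.fontainePstAdicCompletion v ℓ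 hv).IsDeRhamFramed (ρ.toLocal v)) → (∀ (v : IsDedekindDomain.HeightOneSpectrum (NumberField.RingOfIntegers K)) (hv : ((ℓ : ℕ) : NumberField.RingOfIntegers K) ∈ v.asIdeal), (Literature.NumberTheory.PAdicHodge.fontainePstAdicCompletion v ℓ hv).IsCrystallineFramed (ρ.toLocal v)) → (∀ w : IsDedekindDomain.HeightOneSpectrum (NumberField.RingOfIntegers K), ((ℓ : ℕ) : NumberField.RingOfIntegers K) ∉ w.asIdeal → ρ.IsUnramifiedAt w) → ¬ (∀ (L : Type) [Field L] [NumberField L] [Algebra K L], (ρ.restrictField L).toGaloisRep.IsIrreducible) → (∀ (m : ℕ), m < n → ∀ (L : Type) [Field L] [NumberField L], 0 < m → ∀ (ℓ : ℕ) [Fact ℓ.Prime], ℓ ≠ 2 → ∀ (ι : PadicAlgCl ℓ ≃+* ℂ) (σ : Literature.NumberTheory.GaloisRepresentations.FramedGaloisRep L (PadicAlgCl ℓ) m), σ.toGaloisRep.IsIrreducible → ((∀ᶠ v : IsDedekindDomain.HeightOneSpectrum (NumberField.RingOfIntegers L) in cofinite, σ.IsUnramifiedAt v) ∧ ∀ (v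 : IsDedekindDomain.HeightOneSpectrum (NumberField.RingOfIntegers L)) (hv : ((ℓ : ℕ) : NumberField.RingOfIntegers L) ∈ v.asIdeal), (Literature.NumberTheory.PAdicHodge.fontainePstAdicCompletion v ℓ hv).IsDeRhamFramed (σ.toLocal v)) → (∀ (v : IsDedekindDomain.HeightOneSpectrum (NumberField.RingOfIntegers L)) (hv : ((ℓ : ℕ) : NumberField.RingOfIntegers L) ∈ v.asIdeal), (Literature.NumberTheory.PAdicHodge.fontainePstAdicCompletion v ℓ hv).IsCrystallineFramed (σ.toLocal v)) → (∀ w : IsDedekindDomain.HeightOneSpectrum (NumberField.RingOfIntegers L), ((ℓ : ℕ) : NumberField.RingOfIntegers L) ∉ w.asIdeal → σ.IsUnramifiedAt w) → ∀ (ι₂ : PadicAlgCl 2 ≃+* ℂ), ∃ σ₂ : Literature.NumberTheory.GaloisRepresentations.FramedGaloisRep L (PadicAlgCl 2) m, (∀ᶠ v : IsDedekindDomain.HeightOneSpectrum (NumberField.RingOfIntegers L) in cofinite, σ₂.IsUnramifiedAt v) ∧ (∀ᶠ v : IsDedekindDomain.HeightOneSpectrum (NumberField.RingOfIntegers L) in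 cofinite, ∃ α : Multiset ℂ, σ.HasFrobCharpolyAt v (Literature.NumberTheory.Automorphic.arithFrobPolyOfSatake ι v.residueCard 1 α) ∧ σ₂.HasFrobCharpolyAt v (Literature.NumberTheory.Automorphic.arithFrobPolyOfSatake ι₂ v.residueCard 1 α))) → ∀ (ι₂ : PadicAlgCl 2 ≃+* ℂ), ∃ ρ₂ : Literature.NumberTheory.GaloisRepresentations.FramedGaloisRep K (PadicAlgCl 2) n, (∀ᶠ v : IsDedekindDomain.HeightOneSpectrum (NumberField.RingOfIntegers K) in cofinite, ρ₂.IsUnramifiedAt v) ∧ (∀ᶠ v : IsDedekindDomain.HeightOneSpectrum (NumberField.RingOfIntegers K) in cofinite, ∃ α : Multiset ℂ, ρ.HasFrobCharpolyAt v (Literature.NumberTheory.Automorphic.arithFrobPolyOfSatake ι v.residueCard 1 α) ∧ ρ₂.HasFrobCharpolyAt v (Literature.NumberTheory.Automorphic.arithFrobPolyOfSatake ι₂ v.residueCard 1 α))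

/-- The rung is a special case of D′. [bookkeeping] -/
theorem cliffordCompanionStepPrimeDim_of_step (h : CliffordCompanionStep) : CliffordCompanionStepPrimeDim :=
  fun K _ _ n hn _hp => h K n hn

/-- [crux · LAYER 2 under D′ (proposed rank 301) · D · WEAKER than T (`isotypicCompanionDescent_of_T`: its conclusion is
T's conclusion for ρ) · ATTACKABLE on cyclic / solvable layers L/K; dark core = non-solvable everywhere-unramified L/K]
ISOTYPIC DESCENT OF DYADIC COMPANIONS: ρ irreducible level one over K (as in T), L/K finite Galois, σ irreducible level
one over L of dimension m with a·m = n, a ≥ 2, and charpoly ρ|Γ_L = (charpoly σ)^a; if σ has a dyadic companion over L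
then ρ has one over K.  Why it might fail: descending σ₂ (or recognising ρ's companion among the lifts of the projective
descent of σ₂) needs the ISOTYPIC PATTERN of the companion to be ℓ-independent — Galois-side «pattern problem»; for
Gal(L/K) non-solvable no descent mechanism exists in print (Clozel–Rajan solvable descent needs the automorphic side). -/
def IsotypicCompanionDescent : Prop :=
  ∀ (K : Type) [Field K] [NumberField K] (n : ℕ), 0 < n → ∀ (ℓ : ℕ) [Fact ℓ.Prime], ℓ ≠ 2 → ∀ (ι : PadicAlgCl ℓ ≃+* ℂ) (ρ : Literature.NumberTheory.GaloisRepresentations.FramedGaloisRep K (PadicAlgCl ℓ) n), ρ.toGaloisRep.IsIrreducible → ((∀ᶠ v : IsDedekindDomain.HeightOneSpectrum (NumberField.RingOfIntegers K) in cofinite, ρ.IsUnramifiedAt v) ∧ ∀ (v : IsDedekindDomain.HeightOneSpectrum (NumberField.RingOfIntegers K)) (hv : ((ℓ : ℕ) : NumberField.RingOfIntegers K) ∈ v.asIdeal), (Literature.NumberTheory.PAdicHodge.fontainePstAdicCompletion v ℓ hv).IsDeRhamFramed (ρ.toLocal v)) → (∀ (v : IsDedekindDomain.HeightOneSpectrum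 (NumberField.RingOfIntegers K)) (hv : ((ℓ : ℕ) : NumberField.RingOfIntegers K) ∈ v.asIdeal), (Literature.NumberTheory.PAdicHodge.fontainePstAdicCompletion v ℓ hv).IsCrystallineFramed (ρ.toLocal v)) → (∀ w : IsDedekindDomain.HeightOneSpectrum (NumberField.RingOfIntegers K), ((ℓ : ℕ) : NumberField.RingOfIntegers K) ∉ w.asIdeal → ρ.IsUnramifiedAt w) → ∀ (L : Type) [Field L] [NumberField L] [Algebra K L] [IsGalois K L] (m a : ℕ), 2 ≤ a → a * m = n → ∀ (σ : Literature.NumberTheory.GaloisRepresentations.FramedGaloisRep L (PadicAlgCl ℓ) m), σ.toGaloisRep.IsIrreducible → ((∀ᶠ w : IsDedekindDomain.HeightOneSpectrum (NumberField.RingOfIntegers L) in cofinite, σ.IsUnramifiedAt w) ∧ ∀ (w : IsDedekindDomain.HeightOneSpectrum (NumberField.RingOfIntegers L)) (hw : ((ℓ : ℕ) : NumberField.RingOfIntegers L) ∈ w.asIdeal), (Literature.NumberTheory.PAdicHodge.fontainePstAdicCompletion w ℓ hw).IsDeRhamFramed (σ.toLocal w)) → (∀ (w : IsDedekindDomain.HeightOneSpectrum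 (NumberField.RingOfIntegers L)) (hw : ((ℓ : ℕ) : NumberField.RingOfIntegers L) ∈ w.asIdeal), (Literature.NumberTheory.PAdicHodge.fontainePstAdicCompletion w ℓ hw).IsCrystallineFramed (σ.toLocal w)) → (∀ w : IsDedekindDomain.HeightOneSpectrum (NumberField.RingOfIntegers L), ((ℓ : ℕ) : NumberField.RingOfIntegers L) ∉ w.asIdeal → σ.IsUnramifiedAt w) → (∀ g : Field.absoluteGaloisGroup L, Literature.NumberTheory.GaloisRepresentations.FramedRep.charpoly (ρ.restrictField L) g = (Literature.NumberTheory.GaloisRepresentations.FramedRep.charpoly σ g) ^ a) → ∀ (ι₂ : PadicAlgCl 2 ≃+* ℂ), (∃ σ₂ : Literature.NumberTheory.GaloisRepresentations.FramedGaloisRep L (PadicAlgCl 2) m, (∀ᶠ w : IsDedekindDomain.HeightOneSpectrum (NumberField.RingOfIntegers L) in cofinite, σ₂.IsUnramifiedAt w) ∧ (∀ᶠ w : IsDedekindDomain.HeightOneSpectrum (NumberField.RingOfIntegers L) in cofinite, ∃ α : Multiset ℂ, σ.HasFrobCharpolyAt w (Literature.NumberTheory.Automorphic.arithFrobPolyOfSatake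 ι w.residueCard 1 α) ∧ σ₂.HasFrobCharpolyAt w (Literature.NumberTheory.Automorphic.arithFrobPolyOfSatake ι₂ w.residueCard 1 α))) → ∃ ρ₂ : Literature.NumberTheory.GaloisRepresentations.FramedGaloisRep K (PadicAlgCl 2) n, (∀ᶠ v : IsDedekindDomain.HeightOneSpectrum (NumberField.RingOfIntegers K) in cofinite, ρ₂.IsUnramifiedAt v) ∧ (∀ᶠ v : IsDedekindDomain.HeightOneSpectrum (NumberField.RingOfIntegers K) in cofinite, ∃ α : Multiset ℂ, ρ.HasFrobCharpolyAt v (Literature.NumberTheory.Automorphic.arithFrobPolyOfSatake ι v.residueCard 1 α) ∧ ρ₂.HasFrobCharpolyAt v (Literature.NumberTheory.Automorphic.arithFrobPolyOfSatake ι₂ v.residueCard 1 α))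

/-- [support · LAYER 2 under D′ · C · PRINT (Clifford 1937 / Curtis–Reiner *Methods* I §11; Mackey; Artin formalism of induced Frobenius
polynomials, Neukirch VII §10 (10.4)(iv); heredity of «crystalline above ℓ, unramified away from ℓ» under restriction
and direct summands, Fontaine Exp. III Prop. 1.5.2) · PRINT-ASSEMBLABLE from tree lemmas (`FramedGaloisRep.induce`,
`eventually_hasFrobCharpolyAt_induce`, `eventually_isUnramifiedAt_induce`, `exists_semisimplification`,
`exists_conj_eq_reindex_induce_of_not_isIrreducible_restrictField_of_prime`, `RepIsotypicDecomposition`)]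
CLIFFORD REDUCTION: an irreducible level-one ρ : Γ_K → GL_n(ℚ̄_ℓ) that is NOT Lie-irreducible is EITHER companion-
dominated by an irreducible level-one V₁ over a proper finite extension L₁/K of degree d ≥ 2 with d·dim V₁ = n
(ρ ≅ Ind V₁: every dyadic companion of V₁ induces one of ρ), OR has an isotypic restriction pattern σ^{⊕a}, a ≥ 2, with
σ irreducible level one over a finite Galois extension L/K. -/
def CliffordReduction : Prop :=
  ∀ (K : Type) [Field K] [NumberField K] (n : ℕ), 0 < n → ∀ (ℓ : ℕ) [Fact ℓ.Prime], ℓ ≠ 2 → ∀ (ρ : Literature.NumberTheory.GaloisRepresentations.FramedGaloisRep K (PadicAlgCl ℓ) n), ρ.toGaloisRep.IsIrreducible → ((∀ᶠ v : IsDedekindDomain.HeightOneSpectrum (NumberField.RingOfIntegers K) in cofinite, ρ.IsUnramifiedAt v) ∧ ∀ (v : IsDedekindDomain.HeightOneSpectrum (NumberField.RingOfIntegers K)) (hv : ((ℓ : ℕ) : NumberField.RingOfIntegers K) ∈ v.asIdeal), (Literature.NumberTheory.PAdicHodge.fontainePstAdicCompletion v ℓ hv).IsDeRhamFramed (ρ.toLocal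 v)) → (∀ (v : IsDedekindDomain.HeightOneSpectrum (NumberField.RingOfIntegers K)) (hv : ((ℓ : ℕ) : NumberField.RingOfIntegers K) ∈ v.asIdeal), (Literature.NumberTheory.PAdicHodge.fontainePstAdicCompletion v ℓ hv).IsCrystallineFramed (ρ.toLocal v)) → (∀ w : IsDedekindDomain.HeightOneSpectrum (NumberField.RingOfIntegers K), ((ℓ : ℕ) : NumberField.RingOfIntegers K) ∉ w.asIdeal → ρ.IsUnramifiedAt w) → ¬ (∀ (L : Type) [Field L] [NumberField L] [Algebra K L], (ρ.restrictField L).toGaloisRep.IsIrreducible) → (∃ (L₁ : Type) (_ : Field L₁) (_ : NumberField L₁) (_ : Algebra K L₁) (d m : ℕ), 2 ≤ d ∧ d * m = n ∧ Module.finrank K L₁ = d ∧ ∃ V₁ : Literature.NumberTheory.GaloisRepresentations.FramedGaloisRep L₁ (PadicAlgCl ℓ) m, V₁.toGaloisRep.IsIrreducible ∧ ((∀ᶠ w : IsDedekindDomain.HeightOneSpectrum (NumberField.RingOfIntegers L₁) in cofinite, V₁.IsUnramifiedAt w) ∧ ∀ (w : IsDedekindDomain.HeightOneSpectrum (NumberField.RingOfIntegers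 L₁)) (hw : ((ℓ : ℕ) : NumberField.RingOfIntegers L₁) ∈ w.asIdeal), (Literature.NumberTheory.PAdicHodge.fontainePstAdicCompletion w ℓ hw).IsDeRhamFramed (V₁.toLocal w)) ∧ (∀ (w : IsDedekindDomain.HeightOneSpectrum (NumberField.RingOfIntegers L₁)) (hw : ((ℓ : ℕ) : NumberField.RingOfIntegers L₁) ∈ w.asIdeal), (Literature.NumberTheory.PAdicHodge.fontainePstAdicCompletion w ℓ hw).IsCrystallineFramed (V₁.toLocal w)) ∧ (∀ w : IsDedekindDomain.HeightOneSpectrum (NumberField.RingOfIntegers L₁), ((ℓ : ℕ) : NumberField.RingOfIntegers L₁) ∉ w.asIdeal → V₁.IsUnramifiedAt w) ∧ ∀ (ι : PadicAlgCl ℓ ≃+* ℂ) (ι₂ : PadicAlgCl 2 ≃+* ℂ), (∃ V₂ : Literature.NumberTheory.GaloisRepresentations.FramedGaloisRep L₁ (PadicAlgCl 2) m, (∀ᶠ w : IsDedekindDomain.HeightOneSpectrum (NumberField.RingOfIntegers L₁) in cofinite, V₂.IsUnramifiedAt w) ∧ (∀ᶠ w : IsDedekindDomain.HeightOneSpectrum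 (NumberField.RingOfIntegers L₁) in cofinite, ∃ α : Multiset ℂ, V₁.HasFrobCharpolyAt w (Literature.NumberTheory.Automorphic.arithFrobPolyOfSatake ι w.residueCard 1 α) ∧ V₂.HasFrobCharpolyAt w (Literature.NumberTheory.Automorphic.arithFrobPolyOfSatake ι₂ w.residueCard 1 α))) → ∃ ρ₂ : Literature.NumberTheory.GaloisRepresentations.FramedGaloisRep K (PadicAlgCl 2) n, (∀ᶠ v : IsDedekindDomain.HeightOneSpectrum (NumberField.RingOfIntegers K) in cofinite, ρ₂.IsUnramifiedAt v) ∧ (∀ᶠ v : IsDedekindDomain.HeightOneSpectrum (NumberField.RingOfIntegers K) in cofinite, ∃ α : Multiset ℂ, ρ.HasFrobCharpolyAt v (Literature.NumberTheory.Automorphic.arithFrobPolyOfSatake ι v.residueCard 1 α) ∧ ρ₂.HasFrobCharpolyAt v (Literature.NumberTheory.Automorphic.arithFrobPolyOfSatake ι₂ v.residueCard 1 α))) ∨ (∃ (L : Type) (_ : Field L) (_ : NumberField L) (_ : Algebra K L) (_ : IsGalois K L) (m a : ℕ), 2 ≤ a ∧ a * m = n ∧ ∃ σ : Literature.NumberTheory.GaloisRepresentations.FramedGaloisRep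 L (PadicAlgCl ℓ) m, σ.toGaloisRep.IsIrreducible ∧ ((∀ᶠ w : IsDedekindDomain.HeightOneSpectrum (NumberField.RingOfIntegers L) in cofinite, σ.IsUnramifiedAt w) ∧ ∀ (w : IsDedekindDomain.HeightOneSpectrum (NumberField.RingOfIntegers L)) (hw : ((ℓ : ℕ) : NumberField.RingOfIntegers L) ∈ w.asIdeal), (Literature.NumberTheory.PAdicHodge.fontainePstAdicCompletion w ℓ hw).IsDeRhamFramed (σ.toLocal w)) ∧ (∀ (w : IsDedekindDomain.HeightOneSpectrum (NumberField.RingOfIntegers L)) (hw : ((ℓ : ℕ) : NumberField.RingOfIntegers L) ∈ w.asIdeal), (Literature.NumberTheory.PAdicHodge.fontainePstAdicCompletion w ℓ hw).IsCrystallineFramed (σ.toLocal w)) ∧ (∀ w : IsDedekindDomain.HeightOneSpectrum (NumberField.RingOfIntegers L), ((ℓ : ℕ) : NumberField.RingOfIntegers L) ∉ w.asIdeal → σ.IsUnramifiedAt w) ∧ ∀ g : Field.absoluteGaloisGroup L, Literature.NumberTheory.GaloisRepresentations.FramedRep.charpoly (ρ.restrictField L) g = (Literature.NumberTheory.GaloisRepresentations.FramedRep.charpoly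 σ g) ^ a)

/-! ## Bridges: the one-line texts ARE the vocabulary forms (`Iff.rfl`) -/

section Bridges

/-- R in vocabulary form. [bookkeeping] -/
theorem lieIrreducibleCompanion_iff : LieIrreducibleCompanion ↔
    (∀ (K : Type) [Field K] [NumberField K] (n : ℕ), 0 < n → ∀ (ℓ : ℕ) [Fact ℓ.Prime], ℓ ≠ 2 →
      ∀ (ι : PadicAlgCl ℓ ≃+* ℂ) (ρ : FramedGaloisRep K (PadicAlgCl ℓ) n), ρ.toGaloisRep.IsIrreducible →
        IsLieIrreducible ρ → IsPinnedGeometric ρ → IsCrystallineAbove ρ → IsUnramifiedAwayFrom ρ →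
          ∀ (ι₂ : PadicAlgCl 2 ≃+* ℂ), HasDyadicCompanion ι ι₂ ρ) :=
  Iff.rfl

/-- D′ in vocabulary form. [bookkeeping] -/
theorem cliffordCompanionStep_iff : CliffordCompanionStep ↔
    (∀ (K : Type) [Field K] [NumberField K] (n : ℕ), 0 < n → ∀ (ℓ : ℕ) [Fact ℓ.Prime], ℓ ≠ 2 →
      ∀ (ι : PadicAlgCl ℓ ≃+* ℂ) (ρ : FramedGaloisRep K (PadicAlgCl ℓ) n), ρ.toGaloisRep.IsIrreducible →
        IsPinnedGeometric ρ → IsCrystallineAbove ρ → IsUnramifiedAwayFrom ρ → ¬ IsLieIrreducible ρ →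
          (∀ m : ℕ, m < n → DimSlice m) → ∀ (ι₂ : PadicAlgCl 2 ≃+* ℂ), HasDyadicCompanion ι ι₂ ρ) :=
  Iff.rfl

/-- D in vocabulary form. [bookkeeping] -/
theorem isotypicCompanionDescent_iff : IsotypicCompanionDescent ↔
    (∀ (K : Type) [Field K] [NumberField K] (n : ℕ), 0 < n → ∀ (ℓ : ℕ) [Fact ℓ.Prime], ℓ ≠ 2 →
      ∀ (ι : PadicAlgCl ℓ ≃+* ℂ) (ρ : FramedGaloisRep K (PadicAlgCl ℓ) n), ρ.toGaloisRep.IsIrreducible →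
        IsPinnedGeometric ρ → IsCrystallineAbove ρ → IsUnramifiedAwayFrom ρ →
          ∀ (L : Type) [Field L] [NumberField L] [Algebra K L] [IsGalois K L] (m a : ℕ), 2 ≤ a → a * m = n →
            ∀ (σ : FramedGaloisRep L (PadicAlgCl ℓ) m), σ.toGaloisRep.IsIrreducible →
              IsPinnedGeometric σ → IsCrystallineAbove σ → IsUnramifiedAwayFrom σ → IsIsotypicPattern L ρ σ a →
                ∀ (ι₂ : PadicAlgCl 2 ≃+* ℂ), HasDyadicCompanion ι ι₂ σ → HasDyadicCompanion ι ι₂ ρ) :=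
  Iff.rfl

/-- C in vocabulary form. [bookkeeping] -/
theorem cliffordReduction_iff : CliffordReduction ↔
    (∀ (K : Type) [Field K] [NumberField K] (n : ℕ), 0 < n → ∀ (ℓ : ℕ) [Fact ℓ.Prime], ℓ ≠ 2 →
      ∀ (ρ : FramedGaloisRep K (PadicAlgCl ℓ) n), ρ.toGaloisRep.IsIrreducible →
        IsPinnedGeometric ρ → IsCrystallineAbove ρ → IsUnramifiedAwayFrom ρ → ¬ IsLieIrreducible ρ →
          (∃ (L₁ : Type) (_ : Field L₁) (_ : NumberField L₁) (_ : Algebra K L₁) (d m : ℕ), 2 ≤ d ∧ d * m = n ∧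
              Module.finrank K L₁ = d ∧ ∃ V₁ : FramedGaloisRep L₁ (PadicAlgCl ℓ) m, V₁.toGaloisRep.IsIrreducible ∧
                IsPinnedGeometric V₁ ∧ IsCrystallineAbove V₁ ∧ IsUnramifiedAwayFrom V₁ ∧
                  ∀ (ι : PadicAlgCl ℓ ≃+* ℂ) (ι₂ : PadicAlgCl 2 ≃+* ℂ), HasDyadicCompanion ι ι₂ V₁ → HasDyadicCompanion ι ι₂ ρ) ∨
          (∃ (L : Type) (_ : Field L) (_ : NumberField L) (_ : Algebra K L) (_ : IsGalois K L) (m a : ℕ), 2 ≤ a ∧ a * m = n ∧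
              ∃ σ : FramedGaloisRep L (PadicAlgCl ℓ) m, σ.toGaloisRep.IsIrreducible ∧
                IsPinnedGeometric σ ∧ IsCrystallineAbove σ ∧ IsUnramifiedAwayFrom σ ∧ IsIsotypicPattern L ρ σ a)) :=
  Iff.rfl

/-- **T ⟺ all its dimension slices.** [bookkeeping] -/
theorem routeT_iff_slices : Summit.Langlands.Langlands.Theorems.LevelOneDyadic.DyadicContinuousCompanion ↔
    ∀ m : ℕ, DimSlice m :=
  ⟨fun h m L _ _ hm => h L m hm, fun h K _ _ n hn => h n K hn⟩

end Bridges

/-! ## Elementary dimension bookkeeping -/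

/-- If `2 ≤ a` and `a * m = n` with `0 < n` then `0 < m` and `m < n`. -/
theorem pos_and_lt_of_two_le_mul {a m n : ℕ} (ha : 2 ≤ a) (hmn : a * m = n) (hn : 0 < n) : 0 < m ∧ m < n := by
  have hm : 0 < m := by
    rcases Nat.eq_zero_or_pos m with h | h
    · subst h; simp at hmn; omega
    · exact h
  refine ⟨hm, ?_⟩
  calc m < 2 * m := by omega
    _ ≤ a * m := Nat.mul_le_mul_right m ha
    _ = n := hmn

/-! ## KERNEL I — NECESSITY: each open piece follows from T (hence from E, from Z, from `Langlands`) -/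

section Necessity

open Summit.Langlands.Langlands.Theorems.LevelOneDyadic (DyadicContinuousCompanion dyadicContinuousCompanion_iff
  dyadicContinuousCompanion_of_langlands dyadicContinuousCompanion_of_E)

/-- **T ⟹ R** (specialisation: forget the Lie-irreducibility hypothesis). -/
theorem lieIrreducibleCompanion_of_T (hT : DyadicContinuousCompanion) : LieIrreducibleCompanion := by
  rw [lieIrreducibleCompanion_iff]
  intro K _ _ n hn ℓ _ hℓ ι ρ hirr _hLie hgeo hcrys hlvl ι₂
  exact (dyadicContinuousCompanion_iff.mp hT) K n hn ℓ hℓ ι ρ hirr hgeo hcrys hlvl ι₂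

/-- **T ⟹ D** (D's conclusion is T's conclusion for ρ). -/
theorem isotypicCompanionDescent_of_T (hT : DyadicContinuousCompanion) : IsotypicCompanionDescent := by
  rw [isotypicCompanionDescent_iff]
  intro K _ _ n hn ℓ _ hℓ ι ρ hirr hgeo hcrys hlvl L _ _ _ _ m a _ha _hmn σ _ _ _ _ _ ι₂ _
  exact (dyadicContinuousCompanion_iff.mp hT) K n hn ℓ hℓ ι ρ hirr hgeo hcrys hlvl ι₂

/-- **T ⟹ D′** (drop the induction hypothesis and the non-Lie-irreducibility). -/
theorem cliffordCompanionStep_of_T (hT : DyadicContinuousCompanion) : CliffordCompanionStep := by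
  rw [cliffordCompanionStep_iff]
  intro K _ _ n hn ℓ _ hℓ ι ρ hirr hgeo hcrys hlvl _hLie _ih ι₂
  exact (dyadicContinuousCompanion_iff.mp hT) K n hn ℓ hℓ ι ρ hirr hgeo hcrys hlvl ι₂

/-- D′ ⟸ E (tree twin of stmt-Langlands-31932). -/
theorem cliffordCompanionStep_of_E (hE : DyadicCompanionExistence) : CliffordCompanionStep :=
  cliffordCompanionStep_of_T (dyadicContinuousCompanion_of_E hE)

/-- **NECESSITY CERTIFICATE: `Langlands ⟹ D′`.** -/
theorem cliffordCompanionStep_of_langlands (hLg : _root_.Langlands) : CliffordCompanionStep :=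
  cliffordCompanionStep_of_T (dyadicContinuousCompanion_of_langlands hLg)

/-- R ⟸ E (tree twin of stmt-Langlands-31932). -/
theorem lieIrreducibleCompanion_of_E (hE : DyadicCompanionExistence) : LieIrreducibleCompanion :=
  lieIrreducibleCompanion_of_T (dyadicContinuousCompanion_of_E hE)

/-- D ⟸ E (tree twin of stmt-Langlands-31932). -/
theorem isotypicCompanionDescent_of_E (hE : DyadicCompanionExistence) : IsotypicCompanionDescent :=
  isotypicCompanionDescent_of_T (dyadicContinuousCompanion_of_E hE)

/-- **NECESSITY CERTIFICATE: `Langlands ⟹ R`.** -/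
theorem lieIrreducibleCompanion_of_langlands (hLg : _root_.Langlands) : LieIrreducibleCompanion :=
  lieIrreducibleCompanion_of_T (dyadicContinuousCompanion_of_langlands hLg)

/-- **NECESSITY CERTIFICATE: `Langlands ⟹ D`.** -/
theorem isotypicCompanionDescent_of_langlands (hLg : _root_.Langlands) : IsotypicCompanionDescent :=
  isotypicCompanionDescent_of_T (dyadicContinuousCompanion_of_langlands hLg)

end Necessity

/-! ## KERNEL II — EXACTNESS.  Layer 1: T ⟸ R ∧ D′ by strong induction on the dimension (the minimal counterexample is
Lie-irreducible), and T ⟺ R ∧ D′.  Layer 2: D′ ⟸ C ∧ D. -/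

section Exactness

open Summit.Langlands.Langlands.Theorems.LevelOneDyadic (DyadicContinuousCompanion DyadicDeRhamRigidity
  DyadicCompanionExistence DyadicIrreducibilityTransfer DyadicLevelTransfer dyadicContinuousCompanion_iff
  dyadicCompanionExistence_of_TG)

/-- **EXACTNESS KERNEL (layer 1).**  `LieIrreducibleCompanion → CliffordCompanionStep → T`: strong induction on `n` over the
dimension slices of T; at dimension n a level-one irreducible ρ is Lie-irreducible (R) or not (D′ with the induction
hypothesis = all slices below n). -/
theorem dyadicContinuousCompanion_of_pieces (hR : LieIrreducibleCompanion) (hS : CliffordCompanionStep) :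
    DyadicContinuousCompanion := by
  rw [lieIrreducibleCompanion_iff] at hR
  rw [cliffordCompanionStep_iff] at hS
  rw [routeT_iff_slices]
  intro n
  induction n using Nat.strong_induction_on with
  | _ n ih =>
    intro K _ _ hn ℓ _ hℓ ι ρ hirr hgeo hcrys hlvl ι₂
    by_cases hLie : IsLieIrreducible ρ
    · exact hR K n hn ℓ hℓ ι ρ hirr hLie hgeo hcrys hlvl ι₂
    · exact hS K n hn ℓ hℓ ι ρ hirr hgeo hcrys hlvl hLie ih ι₂

/-- **Layer 1 is EXACT: T ⟺ R ∧ D′** (no side hypothesis). -/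
theorem dyadicContinuousCompanion_iff_pieces :
    DyadicContinuousCompanion ↔ (LieIrreducibleCompanion ∧ CliffordCompanionStep) :=
  ⟨fun hT => ⟨lieIrreducibleCompanion_of_T hT, cliffordCompanionStep_of_T hT⟩,
    fun h => dyadicContinuousCompanion_of_pieces h.1 h.2⟩

/-- **EXACTNESS KERNEL (layer 2) = the glue of the later `--split CliffordCompanionStep --into CliffordReduction
IsotypicCompanionDescent`.**  A non-Lie-irreducible level-one irreducible ρ is induced from a level-one irreducible V₁ of
smaller dimension over a proper extension (induction hypothesis for V₁ + C's companion transport), or has an isotypic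
pattern σ^{⊕a}, a ≥ 2, over a finite Galois L/K (induction hypothesis for σ + the descent D). -/
theorem cliffordCompanionStep_of_split (hC : CliffordReduction) (hD : IsotypicCompanionDescent) :
    CliffordCompanionStep := by
  rw [cliffordReduction_iff] at hC
  rw [isotypicCompanionDescent_iff] at hD
  rw [cliffordCompanionStep_iff]
  intro K _ _ n hn ℓ _ hℓ ι ρ hirr hgeo hcrys hlvl hLie ih ι₂
  rcases hC K n hn ℓ hℓ ρ hirr hgeo hcrys hlvl hLie with
    ⟨L₁, _, _, _, d, m, hd, hdm, _, V₁, hV₁irr, hV₁geo, hV₁crys, hV₁lvl, htransport⟩ |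
    ⟨L, _, _, _, _, m, a, ha, ham, σ, hσirr, hσgeo, hσcrys, hσlvl, hpat⟩
  · obtain ⟨hm0, hmn⟩ := pos_and_lt_of_two_le_mul hd hdm hn
    exact htransport ι ι₂ (ih m hmn L₁ hm0 ℓ hℓ ι V₁ hV₁irr hV₁geo hV₁crys hV₁lvl ι₂)
  · obtain ⟨hm0, hmn⟩ := pos_and_lt_of_two_le_mul ha ham hn
    exact hD K n hn ℓ hℓ ι ρ hirr hgeo hcrys hlvl L m a ha ham σ hσirr hσgeo hσcrys hσlvl hpat ι₂
      (ih m hmn L hm0 ℓ hℓ ι σ hσirr hσgeo hσcrys hσlvl ι₂)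

/-- Both layers composed: **T ⟸ R ∧ D ∧ C**. -/
theorem dyadicContinuousCompanion_of_three (hR : LieIrreducibleCompanion) (hD : IsotypicCompanionDescent)
    (hC : CliffordReduction) : DyadicContinuousCompanion :=
  dyadicContinuousCompanion_of_pieces hR (cliffordCompanionStep_of_split hC hD)

/-- E (tree twin of stmt-Langlands-31932) from the layer-1 pieces and G (twin of stmt-Langlands-31994): part 4's glue on top. -/
theorem dyadicCompanionExistence_of_pieces (hR : LieIrreducibleCompanion) (hS : CliffordCompanionStep)
    (hG : DyadicDeRhamRigidity) : DyadicCompanionExistence :=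
  dyadicCompanionExistence_of_TG (dyadicContinuousCompanion_of_pieces hR hS) hG

end Exactness

/-! ## KERNEL III — the pieces + the lineage frame ⟹ `_root_.Langlands` (fourteen binders, through part 4's `langlands_of_four`) -/

section Closes

open Summit.Langlands.Langlands.Theses

/-- **R D′ + G I U + the MinimalLevelDescent frame ⟹ Langlands** (tree version of the node's `closes₉`; binders typed exactly as
part 4's `langlands_of_four`). -/
theorem langlands_of_pieces₉ (hR : LieIrreducibleCompanion) (hS : CliffordCompanionStep)
    (hG : DyadicDeRhamRigidity) (hI : DyadicIrreducibilityTransfer) (hU : DyadicLevelTransfer) (hK : ResidualInertiaDescent)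
    (hWM : MinimalLevelDescent.WeightMove) (hLM : MinimalLevelDescent.LevelMove)
    (hB : MinimalLevelDescent.DyadicLevelOneAutomorphy) (hL : MinimalLevelDescent.AutomorphyLifting)
    (hW : MinimalLevelDescent.SatakeAvatarExistence) (hP : MinimalLevelDescent.PadicMemberCompatibility)
    (hA : MinimalLevelDescent.CompatibilityAwayFromLR) (hCRD : MinimalLevelDescent.CanonicalReciprocityData) :
    _root_.Langlands :=
  langlands_of_four (dyadicContinuousCompanion_of_pieces hR hS) hG hI hU hK hWM hLM hB hL hW hP hA hCRD

/-- After the layer-2 split: R C D + G I U + frame ⟹ Langlands (fifteen binders). -/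
theorem langlands_of_pieces₉_split (hR : LieIrreducibleCompanion) (hC : CliffordReduction) (hD : IsotypicCompanionDescent)
    (hG : DyadicDeRhamRigidity) (hI : DyadicIrreducibilityTransfer) (hU : DyadicLevelTransfer) (hK : ResidualInertiaDescent)
    (hWM : MinimalLevelDescent.WeightMove) (hLM : MinimalLevelDescent.LevelMove)
    (hB : MinimalLevelDescent.DyadicLevelOneAutomorphy) (hL : MinimalLevelDescent.AutomorphyLifting)
    (hW : MinimalLevelDescent.SatakeAvatarExistence) (hP : MinimalLevelDescent.PadicMemberCompatibility)
    (hA : MinimalLevelDescent.CompatibilityAwayFromLR) (hCRD : MinimalLevelDescent.CanonicalReciprocityData) :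
    _root_.Langlands :=
  langlands_of_pieces₉ hR (cliffordCompanionStep_of_split hC hD) hG hI hU hK hWM hLM hB hL hW hP hA hCRD

end Closes

end Summit.Langlands.Langlands.Theorems.LevelOneDyadic.Clifford

/-! ## Axiom audit of the kernels (standard axioms only) -/
#print axioms Summit.Langlands.Langlands.Theorems.LevelOneDyadic.Clifford.langlands_of_pieces₉
#print axioms Summit.Langlands.Langlands.Theorems.LevelOneDyadic.Clifford.langlands_of_pieces₉_split
#print axioms Summit.Langlands.Langlands.Theorems.LevelOneDyadic.Clifford.dyadicContinuousCompanion_of_pieces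
#print axioms Summit.Langlands.Langlands.Theorems.LevelOneDyadic.Clifford.dyadicContinuousCompanion_iff_pieces
#print axioms Summit.Langlands.Langlands.Theorems.LevelOneDyadic.Clifford.cliffordCompanionStep_of_split
#print axioms Summit.Langlands.Langlands.Theorems.LevelOneDyadic.Clifford.lieIrreducibleCompanion_of_langlands
#print axioms Summit.Langlands.Langlands.Theorems.LevelOneDyadic.Clifford.cliffordCompanionStep_of_langlands
#print axioms Summit.Langlands.Langlands.Theorems.LevelOneDyadic.Clifford.isotypicCompanionDescent_of_langlands
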